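import Literature.MathematicalPhysics.QuantumLattice.TorusPlaquetteHamiltonian
import Literature.MathematicalPhysics.QuantumLattice.InterClusterKernelIdentification
import HarnessLib

/-!
# Product states of plaquette vectors on the checkerboard torus: norms and the intra-plaquette energy

Consequences of the Koszul product-state calculus (`ClusterProductStates`), the plaquette partition
(`TorusPlaquettePartition`) and the block decomposition of the intra-plaquette Hamiltonian
(`TorusPlaquetteHamiltonian`) — the linear-algebra content of clauses (a)–(b) of the plaquette-boson
dictionary (Tsai–Kivelson 2006, App. A; Yao–Tsai–Kivelson 2007, eq. (2)): for a general ordered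
cluster partition `P`,

* `prodFamily_update_smul`: the product state is linear in each factor (scalars);
* `sum_jwEmbed_mulVec_prodFamily_of_eigenvector`: if every factor `ψ_c` is an eigenvector of an
  even cluster operator `a_c` with eigenvalue `E_c`, then `(Σ_c jwEmbed (emb c) a_c) (⊗ ψ) = (Σ_c E_c) (⊗ ψ)`
  — the energies of decoupled clusters add;
* `star_prodFamily_dotProduct_self`: `‖⊗ ψ‖² = Π ‖ψ_c‖²` (unit factors give a unit product state);

and for the `2M`-torus (`M ≥ 2`):

* **`hamiltonian_intra_mulVec_prodFamily`**: a product `⊗_R ψ_R` of eigenvectors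
  `plaquetteHamiltonian U ψ_R = E_R ψ_R` of the plaquettes is an eigenvector of the summit's
  intra-plaquette Hamiltonian `hamiltonian (fermionTorusGraph 2 (2M) \ comap (·/2) ⊤) 1 U` with
  eigenvalue `Σ_R E_R` — e.g. `(M² − N_b) E(0h) + N_b E(2h)` for `N_b` plaquettes in `|2h⟩` and the
  rest in `|0h⟩`.

References: W.-F. Tsai, S. A. Kivelson, PRB 73 (2006) 214510, App. A [TsaiKivelson2006]; H. Yao,
W.-F. Tsai, S. A. Kivelson, PRB 76 (2007) 161104(R), eq. (2) [YaoTsaiKivelson2007].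
-/

noncomputable section

namespace Literature.MathematicalPhysics.QuantumLattice

open Matrix Finset TwoCluster

namespace ClusterProduct.Partition

variable {ι' C κ : Type*} [LinearOrder ι'] [LinearOrder C] [LinearOrder κ] (P : Partition ι' C κ)

/-- **The product state is linear in each factor**: rescaling one factor rescales the product.
[folklore] -/
theorem prodFamily_update_smul [Fintype C] [DecidableEq C] (ψ : C → Fock κ) (c₀ : C) (a : ℂ) :
    P.prodFamily (Function.update ψ c₀ (a • ψ c₀)) = a • P.prodFamily ψ := by
  funext s
  rw [Pi.smul_apply, prodFamily_apply, prodFamily_apply, smul_eq_mul,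
    ← Finset.mul_prod_erase _ _ (Finset.mem_univ c₀), ← Finset.mul_prod_erase Finset.univ
      (fun c => ψ c (P.part c s)) (Finset.mem_univ c₀), Function.update_self, Pi.smul_apply, smul_eq_mul]
  have h : ∏ c ∈ Finset.univ.erase c₀, Function.update ψ c₀ (a • ψ c₀) c (P.part c s) =
      ∏ c ∈ Finset.univ.erase c₀, ψ c (P.part c s) :=
    Finset.prod_congr rfl fun c hc => by rw [Function.update_of_ne (Finset.ne_of_mem_erase hc)]
  rw [h]
  ring

/-- **Energies of decoupled clusters add**: if each factor is an eigenvector of an even cluster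
operator, the product state is an eigenvector of the sum of the embedded operators with the sum of
the eigenvalues. [cite: TsaiKivelson2006, App. A] -/
theorem sum_jwEmbed_mulVec_prodFamily_of_eigenvector [Fintype ι'] [Fintype C] [Fintype κ]
    {a : C → Matrix (Finset κ) (Finset κ) ℂ} (ha : ∀ c, IsParityPreserving (a c)) {ψ : C → Fock κ}
    {E : C → ℂ} (hψ : ∀ c, a c *ᵥ ψ c = E c • ψ c) :
    (∑ c, jwEmbed (P.emb c) (a c)) *ᵥ P.prodFamily ψ = (∑ c, E c) • P.prodFamily ψ := by
  classical
  rw [sum_mulVec, Finset.sum_smul]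
  refine Finset.sum_congr rfl fun c _ => ?_
  rw [P.jwEmbed_mulVec_prodFamily (ha c), hψ c, P.prodFamily_update_smul]

/-- **Norms multiply**: `⟨⊗ ψ, ⊗ ψ⟩ = Π_c ⟨ψ_c, ψ_c⟩`; unit factors give a unit product state.
[folklore] -/
theorem star_prodFamily_dotProduct_self [Fintype ι'] [Fintype C] [Fintype κ] (ψ : C → Fock κ)
    (hψ : ∀ c, star (ψ c) ⬝ᵥ ψ c = 1) : star (P.prodFamily ψ) ⬝ᵥ P.prodFamily ψ = 1 := by
  rw [P.star_prodFamily_dotProduct_prodFamily]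
  exact Finset.prod_eq_one fun c _ => hψ c

end ClusterProduct.Partition

namespace TorusPlaquette

variable {M : ℕ}

/-- **A product of plaquette eigenvectors is an eigenvector of the intra-plaquette Hamiltonian of
the checkerboard torus, with the sum of the plaquette energies** (`M ≥ 2`): for
`plaquetteHamiltonian U ψ_R = E_R ψ_R`,
`hamiltonian (fermionTorusGraph 2 (2M) \ comap (·/2) ⊤) 1 U (⊗_R ψ_R) = (Σ_R E_R) (⊗_R ψ_R)`.
[cite: TsaiKivelson2006, App. A] -/
theorem hamiltonian_intra_mulVec_prodFamily (hM : 2 ≤ M) (U : ℝ) {ψ : FermionTorus 2 M → Fock (Orb PlaquetteSite)}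
    {E : FermionTorus 2 M → ℂ} (hψ : ∀ R, plaquetteHamiltonian U *ᵥ ψ R = E R • ψ R) :
    hamiltonian (fermionTorusGraph 2 (2 * M) \
        SimpleGraph.comap (fun x : FermionTorus 2 (2 * M) => fun i : Fin 2 => ((ofLex x) i : ℕ) / 2) ⊤) 1 U *ᵥ
        (plaquettePartition M).prodFamily ψ =
      (∑ R, E R) • (plaquettePartition M).prodFamily ψ := by
  rw [hamiltonian_intra_eq_sum_jwEmbed_plaquetteHamiltonian hM U]
  exact (plaquettePartition M).sum_jwEmbed_mulVec_prodFamily_of_eigenvector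
    (fun _ => isParityPreserving_plaquetteHamiltonian U) hψ

end TorusPlaquette

end Literature.MathematicalPhysics.QuantumLattice

end
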